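import Literature.NumberTheory.LFunctions.IwaniecSarnakFamilyHalfEdge
import Literature.NumberTheory.LFunctions.CentralValueFamilyNontrivialTwist
import Literature.NumberTheory.LFunctions.KowalskiMichelHarmonicMoments
import Literature.NumberTheory.EllipticCurves.CuspFormLFunctionNewformFrickeProofs
import HarnessLib

/-!
# The `𝓗_k(N)` instance of the corrected ½-proportion edge; weight `2`, prime level
# (Iwaniec 2006 §7 (7.3)–(7.7) with Kowalski–Michel 2000 for the even share)

Topic `Literature/NumberTheory/LFunctions` (namespace
`Literature.NumberTheory.LFunctions.CentralValueFamilyHalfEdge`). GLUE and PROOFS only — NO named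
fact is introduced (D-0026). Continues `CentralValueFamilyNontrivialTwist` (the explosion of the
even-mass shapes at the trivial twist; the total-mass shapes; the `refine` device) for the concrete
family `iwaniecSarnakFamily k` = `𝓗_k(N)` of `IwaniecSarnakFamilyHalfEdge`:

1. **The explosion, instantiated**: `𝓗_k(N)` is trivially compatible (`(N,1) = 1`, `𝟙(−N) = 1`)
   and has squarefree levels of unbounded size, so — given the non-negativity fact
   `lapidRallis2003_theorem1_gl2Twist` — `(iwaniecSarnakFamily k).EvenMassPos` and
   `(iwaniecSarnakFamily k).MixedOverMass δ` (`δ ≥ 0`) are jointly contradictory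
   (`iwaniecSarnakFamily_not_mixedOverMass`), as are `EvenMassLower` and `MixedMomentUpper δ`
   (`iwaniecSarnakFamily_not_mixedMomentUpper`): the hypotheses of
   `lOne_lowerBound_of_untwistedProportion{,_ratio}` cannot all hold.
2. **The printed moment input**: the named fact `IwaniecSarnak.iwaniec2006_mixedMomentOverMass`
   ((7.3)+(7.4) of [IwaniecConversations2006, §7 p. 96] in one-sided ratio form against the TOTAL
   harmonic mass, `1 < D`) gives `(iwaniecSarnakFamily k).MixedOverTotalMass δ` for some `δ > 0`
   (`mixedOverTotalMass_iwaniecSarnakFamily`).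
3. **The even share at prime level and weight `2`, PROVED from typed Petersson facts**: for a prime
   level `q`, `Σ^h_{f ∈ H_2(q)} λ_f(1)² = 1 + O(q^{−3/2})` (`KowalskiMichel2000.kowalskiMichel2000_petersson`
   at `(m,n) = (1,1)`) and `2 Σ^h_f ε_f^− λ_f(1)² = 1 + O(q^{−1})` (`kowalskiMichel2000_lemma1` at
   `(l,m) = (1,1)`), with `λ_f(1) = 1` for newforms and `ε_f = ±1` (Atkin–Lehner, tree theorem
   `IsNewform0.frickeEigenvalue_eq_one_or_eq_neg_one_holds`), give total harmonic mass `∈ [7/8, 9/8]`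
   and even harmonic mass `≥ 1/4 ≥ (1/5)·total` for all large primes `q`: `EvenShare` for the
   refinement `primeLevelFamilyTwo` of `iwaniecSarnakFamily 2` to PRIME admissible levels and
   NON-TRIVIAL compatible twists (`evenShare_primeLevelFamilyTwo`). Compatible supply by prime
   levels `p ≡ −1 (mod D)` (Linnik) is inherited (`PrimeLevels.refine`,
   `primeLevelFamilyTwo_compatibleSupply`).
4. **THE WEIGHT-2 DECISION THEOREM** `lOne_lowerBound_of_untwistedProportion_weightTwo`: the printed
   facts `lapidRallis2003_theorem1_gl2Twist` (non-negativity), `iwaniec2006_twistedHalf` ((7.6) at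
   `½`), `iwaniec2006_mixedMomentOverMass` ((7.3)+(7.4)), `kowalskiMichel2000_petersson`,
   `kowalskiMichel2000_lemma1` (Petersson at prime level), and the EDGE
   `IwaniecSarnak.UntwistedProportion 2 (½ + η)` for some `η > 0` imply
   `∃ c > 0, L(1,χ_D) ≥ c·(log D)^{−4}` for all large `D` and all real primitive `χ mod D`.
   Every hypothesis except the edge is a typed statement IN PRINT; the edge is open in print
   («Fifty percent is not enough!»).

WHAT THIS IS NOT: no claim that `UntwistedProportion 2 (½ + η)` holds for any `η > 0`, nor about
Landau–Siegel zeros. «The programme SEARCHES and TYPES; no claim about Landau–Siegel zeros,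
Theorems 1–2 of arXiv:2211.02515 or a repaired Margin232 until a kernel theorem says so.»

## References

* [IwaniecConversations2006] H. Iwaniec, LNM 1891 (2006), §7 (7.3)–(7.7), held chunks p0095–p0097.
* [KowalskiMichel2000] E. Kowalski, P. Michel, Acta Arith. 94 (2000), §2.3 (display after (16)),
  Lemma 1 — typed in `KowalskiMichelHarmonicMoments`.
* [Knapp1993] Thm. 9.27 (Atkin–Lehner: `ε(f) = ±1`), tree theorem
  `IsNewform0.frickeEigenvalue_eq_one_or_eq_neg_one_holds`.
* [Linnik1944] (tree theorem `linnik_leastPrimeAP`, via `compatibleSupply_of_primeLevels`).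
-/

noncomputable section

namespace Literature.NumberTheory.LFunctions.CentralValueFamilyHalfEdge

open scoped MatrixGroups
open Finset Real CongruenceSubgroup Complex
open Literature.NumberTheory.EllipticCurves.ModularForms
open Literature.NumberTheory.LFunctions.IwaniecSarnak

namespace CentralValueFamily

variable {𝓕 : CentralValueFamily} {A : 𝓕.Param → Prop} {B : ℕ → Prop}

/-! ## Prime-level structures survive refinement -/

/-- A prime-level structure whose large prime levels satisfy `A` is a prime-level structure of the
`A`-refined datum (conductor condition trivial). [cite: IwaniecConversations2006, §4 (4.10)] -/
def PrimeLevels.refine (Λ : 𝓕.PrimeLevels) (hA : ∀ p : ℕ, p.Prime → Λ.N₀ ≤ p → A (Λ.lvl p)) :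
    (𝓕.refine A (fun _ => True)).PrimeLevels where
  lvl := Λ.lvl
  size_lvl := Λ.size_lvl
  N₀ := Λ.N₀
  admissible := fun p hp hN => ⟨Λ.admissible p hp hN, hA p hp hN⟩
  compatible := fun p D _ χ hp hDp hmod hprim hquad =>
    ⟨Λ.compatible p D χ hp hDp hmod hprim hquad, trivial⟩

/-- **Compatible supply for a refined datum**: prime levels satisfying `A` and a conductor condition
holding for all large `D` give `CompatibleSupply δ K` for every `δ > 0` (Linnik, via
`compatibleSupply_of_primeLevels`). [cite: Linnik1944] -/
theorem compatibleSupply_refine (Λ : 𝓕.PrimeLevels)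
    (hA : ∀ p : ℕ, p.Prime → Λ.N₀ ≤ p → A (Λ.lvl p)) (D₁ : ℕ) (hB : ∀ D, D₁ ≤ D → B D)
    {δ : ℝ} (hδ : 0 < δ) : ∃ K : ℝ, 0 < K ∧ (𝓕.refine A B).CompatibleSupply δ K := by
  obtain ⟨K, hK, h⟩ := (𝓕.refine A (fun _ => True)).compatibleSupply_of_primeLevels (Λ.refine hA) hδ
  exact ⟨K, hK, compatibleSupply_refine_mono (B := fun _ => True) D₁ (fun D hD _ => hB D hD) h⟩

/-- `MixedOverTotalMass` is antitone in the uniformity exponent (sizes `≥ 1`).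
[cite: IwaniecConversations2006, §7 (7.4)] -/
theorem MixedOverTotalMass.anti {δ δ' : ℝ} (hδ' : δ' ≤ δ) (h : 𝓕.MixedOverTotalMass δ) :
    𝓕.MixedOverTotalMass δ' := by
  obtain ⟨C, hC, s₀, hs⟩ := h
  refine ⟨C, hC, max s₀ 1, fun P hadm hsz D _ χ hprim hquad hD hDle hcomp => ?_⟩
  have h1 : (1 : ℝ) ≤ 𝓕.size P := le_trans (le_max_right _ _) hsz
  exact hs P hadm (le_trans (le_max_left _ _) hsz) D χ hprim hquad hD
    (le_trans hDle (Real.rpow_le_rpow_of_exponent_le h1 hδ')) hcomp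

end CentralValueFamily

/-! ## `𝓗_k(N)`: the explosion instantiated -/

section Explosion

variable {k : ℤ}

/-- `𝓗_k(N)` is trivially compatible: `(N, 1) = 1` and the trivial character mod `1` takes the value
`1` at `−N`. [cite: IwaniecConversations2006, §4 (4.10)] -/
theorem iwaniecSarnakFamily_triviallyCompatible (k : ℤ) : (iwaniecSarnakFamily k).TriviallyCompatible :=
  fun _ _ => ⟨Nat.coprime_one_right _, MulChar.one_apply (isUnit_of_subsingleton _)⟩

/-- `𝓗_k(N)` has admissible (squarefree) levels of unbounded size: primes.
[cite: IwaniecConversations2006, §7 (7.3)] -/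
theorem iwaniecSarnakFamily_unbounded (k : ℤ) : (iwaniecSarnakFamily k).Unbounded := by
  intro s
  obtain ⟨p, hp, hprime⟩ := Nat.exists_infinite_primes (⌈s⌉₊ + 1)
  refine ⟨⟨p, hprime.pos⟩, hprime.squarefree, ?_⟩
  show s ≤ ((p : ℕ) : ℝ)
  have : (⌈s⌉₊ : ℝ) + 1 ≤ (p : ℝ) := by exact_mod_cast hp
  linarith [Nat.le_ceil s]

/-- **The landed even-mass ratio shape is contradictory for `𝓗_k(N)`**: given the non-negativity
fact (Lapid–Rallis / Guo), `EvenMassPos` and `MixedOverMass δ` (`δ ≥ 0`) cannot both hold — at the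
trivial twist `D = 1` the shape asks `0 ≤ Σ^h ω L(½,f)² ≤ C · Σ^h_{even} ω · ζ(1) < 0` (Mathlib's
junk `ζ(1) = (γ − log 4π)/2`). The hypotheses of `lOne_lowerBound_of_untwistedProportion_ratio` are
therefore jointly unsatisfiable; use the `_weightTwo` / `_total` forms.
[cite: IwaniecConversations2006, §7 (7.4)] -/
theorem iwaniecSarnakFamily_not_mixedOverMass (hk : 2 ≤ k) (hLR : lapidRallis2003_theorem1_gl2Twist)
    (hpos : (iwaniecSarnakFamily k).EvenMassPos) {δ : ℝ} (hδ : 0 ≤ δ) :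
    ¬ (iwaniecSarnakFamily k).MixedOverMass δ :=
  CentralValueFamily.not_mixedOverMass_of_evenMassPos (iwaniecSarnakFamily_nonnegOn hk hLR)
    (iwaniecSarnakFamily_triviallyCompatible k) (iwaniecSarnakFamily_unbounded k) hpos hδ

/-- The same for the survey-normalised shapes: `EvenMassLower` and `MixedMomentUpper δ` (`δ ≥ 0`)
cannot both hold for `𝓗_k(N)` given the non-negativity fact — the hypotheses of
`lOne_lowerBound_iwaniecSarnakFamily` / `lOne_lowerBound_of_untwistedProportion` are jointly
unsatisfiable. [cite: IwaniecConversations2006, §7 (7.4)] -/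
theorem iwaniecSarnakFamily_not_mixedMomentUpper (hk : 2 ≤ k)
    (hLR : lapidRallis2003_theorem1_gl2Twist) (hlow : (iwaniecSarnakFamily k).EvenMassLower)
    {δ : ℝ} (hδ : 0 ≤ δ) : ¬ (iwaniecSarnakFamily k).MixedMomentUpper δ :=
  CentralValueFamily.not_mixedMomentUpper_of_evenMassLower (iwaniecSarnakFamily_nonnegOn hk hLR)
    (iwaniecSarnakFamily_triviallyCompatible k) (iwaniecSarnakFamily_unbounded k) hlow hδ

end Explosion

/-! ## `𝓗_k(N)`: the printed moment input (7.3)+(7.4) against the total mass -/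

section TotalMass

variable {k : ℤ}

/-- The total mass of the datum at level `N` is the harmonic sum `Σ^h_{f ∈ H_k(N)} 1`.
[cite: IwaniecConversations2006, §7 (7.3)] -/
theorem totalMass_iwaniecSarnakFamily (N : ℕ+) :
    (iwaniecSarnakFamily k).totalMass N = harmonicSum (N : ℕ) k (fun _ => 1) := by
  rw [harmonicSum_one_eq (finite_newforms0_holds (N : ℕ) k)]
  rfl

/-- **The named fact (7.3)+(7.4) feeds the total-mass shape**: `iwaniec2006_mixedMomentOverMass` ⇒
`(iwaniecSarnakFamily k).MixedOverTotalMass δ` for some `δ > 0` (each even `k ≥ 2`); compatibility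
`(N,D) = 1 ∧ χ(−N) = 1` supplies the coprimality the fact asks. [cite: IwaniecConversations2006, §7 (7.3)–(7.4)] -/
theorem mixedOverTotalMass_iwaniecSarnakFamily (hk : 2 ≤ k) (hkev : Even k)
    (h : iwaniec2006_mixedMomentOverMass) :
    ∃ δ : ℝ, 0 < δ ∧ (iwaniecSarnakFamily k).MixedOverTotalMass δ := by
  obtain ⟨δ, hδ, C, hC, N₀, hN₀⟩ := h k hk hkev
  refine ⟨δ, hδ, C, hC, (N₀ : ℝ), fun (N : ℕ+) (hsq : Squarefree (N : ℕ))
    (hN : (N₀ : ℝ) ≤ ((N : ℕ) : ℝ)) D _ χ hprim hquad hD hDle hcomp => ?_⟩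
  have hN' : N₀ ≤ (N : ℕ) := by exact_mod_cast hN
  rw [mixedMoment_iwaniecSarnakFamily, totalMass_iwaniecSarnakFamily]
  exact hN₀ (N : ℕ) hN' hsq D χ hprim hquad hD hcomp.1 hDle

end TotalMass

/-! ## Weight `2`, prime level: the even share from the Petersson facts -/

section WeightTwo

open KowalskiMichel2000 GL2Family in
/-- For a newform `f` of even weight `2`, the root number `w_f = i² ε_Fricke(f) = −ε_Fricke(f)` is
`+1` or `−1` (Atkin–Lehner). [cite: Knapp1993, Thm. 9.27] -/
theorem rootNumber_eq_one_or_weightTwo {N : ℕ} [NeZero N] {f : CuspForm (Gamma0 N) 2}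
    (hf : f ∈ newforms0 N 2) : rootNumber f = 1 ∨ rootNumber f = -1 := by
  have hε := IsNewform0.frickeEigenvalue_eq_one_or_eq_neg_one_holds (N := N) (k := (2 : ℤ)) hf
  have hI : Complex.I ^ (2 : ℤ) = -1 := by rw [zpow_two, Complex.I_mul_I]
  unfold rootNumber
  rw [hI]
  rcases hε with h | h <;> rw [h] <;> norm_num

/-- At a newform, Kowalski–Michel's odd projector `ε_f^− = (1 − w_f)/2` is the indicator of
`w_f ≠ 1` (weight `2`). [cite: KowalskiMichel2000, §2.2 (ε_f^±)] -/
theorem epsMinus_eq_indicator {N : ℕ} [NeZero N] {f : CuspForm (Gamma0 N) 2}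
    (hf : f ∈ newforms0 N 2) :
    KowalskiMichel2000.epsMinus f = ((if rootNumber f = 1 then (0 : ℝ) else 1 : ℝ) : ℂ) := by
  unfold KowalskiMichel2000.epsMinus
  rcases rootNumber_eq_one_or_weightTwo hf with h | h
  · rw [if_pos h, h]; norm_num
  · have hne : rootNumber f ≠ 1 := by rw [h]; norm_num
    rw [if_neg hne, h]; norm_num

/-- `Σ^h_{f ∈ H_2(q)} λ_f(1)λ_f(1)` (Kowalski–Michel's `pet q 1 1`) is the total harmonic mass
(`λ_f(1) = 1` for newforms). [cite: KowalskiMichel2000, §2.3 (display after (16))] -/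
theorem pet_one_one (q : ℕ) [NeZero q] :
    KowalskiMichel2000.pet q 1 1 = ((harmonicSum q 2 (fun _ => (1 : ℝ)) : ℝ) : ℂ) := by
  rw [KowalskiMichel2000.ofReal_harmonicSum]
  unfold KowalskiMichel2000.pet GL2Family.harmonicSum
  refine finsum_mem_congr rfl fun f hf => ?_
  have hf' : IsNewform0 f := hf
  beta_reduce
  rw [GL2Family.heckeLambda_one_of_isNormalized hf'.2.2]
  push_cast
  ring

/-- `Δ⁻(1,1) = 2 Σ^h_f ε_f^− λ_f(1)²` (Kowalski–Michel) is twice the ODD harmonic mass.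
[cite: KowalskiMichel2000, (14) (definition of Δ⁻)] -/
theorem deltaMinus_one_one (q : ℕ) [NeZero q] :
    KowalskiMichel2000.DeltaMinus q 1 1 =
      2 * ((harmonicSum q 2 (fun f => if rootNumber f = 1 then (0 : ℝ) else 1) : ℝ) : ℂ) := by
  rw [KowalskiMichel2000.ofReal_harmonicSum]
  unfold KowalskiMichel2000.DeltaMinus GL2Family.harmonicSum
  congr 1
  refine finsum_mem_congr rfl fun f hf => ?_
  have hf' : IsNewform0 f := hf
  beta_reduce
  rw [GL2Family.heckeLambda_one_of_isNormalized hf'.2.2, epsMinus_eq_indicator hf]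
  ring

/-- The total harmonic mass splits as even + odd. [cite: IwaniecConversations2006, §7 (7.3)] -/
theorem harmonicSum_one_eq_even_add_odd (q : ℕ) [NeZero q] :
    harmonicSum q 2 (fun _ => (1 : ℝ)) =
      harmonicSum q 2 (fun f => if rootNumber f = 1 then (1 : ℝ) else 0) +
        harmonicSum q 2 (fun f => if rootNumber f = 1 then (0 : ℝ) else 1) := by
  have hfin := finite_newforms0_holds q 2
  rw [harmonicSum_eq_sum hfin, harmonicSum_eq_sum hfin, harmonicSum_eq_sum hfin,
    ← Finset.sum_add_distrib]
  refine Finset.sum_congr rfl fun f _ => ?_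
  split_ifs <;> ring

/-- **Total and odd harmonic masses at prime level, weight `2`, from the Petersson facts**: there are
`C₁, C₂` with `|Σ^h 1 − 1| ≤ C₁ q^{−3/2}` and `|2·Σ^h_{odd} 1 − 1| ≤ C₂ q^{−1}` for every prime `q`
(Kowalski–Michel, display after (16) at `(m,n) = (1,1)` and Lemma 1 at `(l,m) = (1,1)`).
[cite: KowalskiMichel2000, §2.3 (display after (16)) and Lemma 1] -/
theorem masses_prime_weightTwo (hP : KowalskiMichel2000.kowalskiMichel2000_petersson)
    (hL : KowalskiMichel2000.kowalskiMichel2000_lemma1) :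
    ∃ C₁ C₂ : ℝ, ∀ (q : ℕ) [NeZero q], q.Prime →
      |harmonicSum q 2 (fun _ => (1 : ℝ)) - 1| ≤ C₁ * (q : ℝ) ^ (-(3 / 2 : ℝ)) ∧
      |2 * harmonicSum q 2 (fun f => if rootNumber f = 1 then (0 : ℝ) else 1) - 1| ≤ C₂ / q := by
  obtain ⟨C₁, h₁⟩ := hP 1 one_pos
  obtain ⟨C₂, h₂⟩ := hL 1 one_pos
  refine ⟨C₁, C₂, fun q _ hq => ⟨?_, ?_⟩⟩
  · have h := h₁ q hq 1 1 le_rfl le_rfl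
    rw [pet_one_one, if_pos rfl] at h
    have e : (((harmonicSum q 2 (fun _ => (1 : ℝ)) : ℝ) : ℂ) - 1) =
        (((harmonicSum q 2 (fun _ => (1 : ℝ)) - 1 : ℝ)) : ℂ) := by push_cast; ring
    rw [e, Complex.norm_real, Real.norm_eq_abs] at h
    simpa using h
  · have h := h₂ q hq 1 1 le_rfl le_rfl hq.one_lt.le
    rw [deltaMinus_one_one, if_pos rfl] at h
    have e : (2 * (((harmonicSum q 2 (fun f => if rootNumber f = 1 then (0 : ℝ) else 1)) : ℝ) : ℂ)
        - 1) = (((2 * harmonicSum q 2 (fun f => if rootNumber f = 1 then (0 : ℝ) else 1) - 1 : ℝ))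
          : ℂ) := by push_cast; ring
    rw [e, Complex.norm_real, Real.norm_eq_abs] at h
    simpa using h

/-- **The weight-2 prime-level family with non-trivial twists**: `𝓗_2(N)` with admissibility
restricted to PRIME levels and compatibility to conductors `D > 1` (device `refine`; the compatible
supply of `𝓗_k(N)` is by prime levels anyway, and print's `χ_D` has `D > 1`).
[cite: IwaniecConversations2006, §7 (7.3)–(7.6)] -/
abbrev primeLevelFamilyTwo : CentralValueFamily :=
  (iwaniecSarnakFamily 2).refine (fun N => (N : ℕ).Prime) (fun D => 1 < D)

/-- Compatible supply for `primeLevelFamilyTwo` in every uniformity range (Linnik: prime levels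
`p ≡ −1 (mod D)`, which are prime and have `D ≥ 2` eventually). [cite: Linnik1944] -/
theorem primeLevelFamilyTwo_compatibleSupply {δ : ℝ} (hδ : 0 < δ) :
    ∃ K : ℝ, 0 < K ∧ primeLevelFamilyTwo.CompatibleSupply δ K :=
  CentralValueFamily.compatibleSupply_refine (iwaniecSarnakPrimeLevels 2)
    (fun p hp _ => by
      show (max p 1 : ℕ).Prime
      rw [max_eq_left hp.one_lt.le]; exact hp)
    2 (fun _ hD => hD) hδ

/-- **Even share at prime level, weight `2` (root-number equidistribution in harmonic measure)**:
for all large primes `q`, `Σ^h_{w_f = 1} ω_f ≥ (1/5)·Σ^h ω_f` and `Σ^h ω_f > 0` over `H_2(q)` — from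
the Petersson facts: total mass `∈ [7/8, 9/8]`, odd mass `≤ 5/8`, even `= total − odd ≥ 1/4`.
[cite: KowalskiMichel2000, §2.3 (display after (16)) and Lemma 1] -/
theorem evenShare_primeLevelFamilyTwo (hP : KowalskiMichel2000.kowalskiMichel2000_petersson)
    (hL : KowalskiMichel2000.kowalskiMichel2000_lemma1) : primeLevelFamilyTwo.EvenShare := by
  obtain ⟨C₁, C₂, hC⟩ := masses_prime_weightTwo hP hL
  refine ⟨1 / 5, by norm_num, max (max (8 * C₁) (4 * C₂)) 1,
    fun (N : ℕ+) (hadm : Squarefree (N : ℕ) ∧ (N : ℕ).Prime)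
      (hsz : max (max (8 * C₁) (4 * C₂)) 1 ≤ ((N : ℕ) : ℝ)) => ?_⟩
  obtain ⟨_, hprime⟩ := hadm
  show 1 / 5 * (iwaniecSarnakFamily 2).totalMass N ≤ (iwaniecSarnakFamily 2).evenMass N ∧
    0 < (iwaniecSarnakFamily 2).totalMass N
  rw [totalMass_iwaniecSarnakFamily, evenMass_iwaniecSarnakFamily]
  set q : ℕ := (N : ℕ) with hqdef
  have hq1 : (1 : ℝ) ≤ q := le_trans (le_max_right _ _) hsz
  have hqpos : (0 : ℝ) < q := lt_of_lt_of_le one_pos hq1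
  have h8 : 8 * C₁ ≤ q := le_trans (le_trans (le_max_left _ _) (le_max_left _ _)) hsz
  have h4 : 4 * C₂ ≤ q := le_trans (le_trans (le_max_right _ _) (le_max_left _ _)) hsz
  obtain ⟨hT, hO⟩ := hC q hprime
  -- the two error terms are ≤ 1/8 and ≤ 1/4
  have ha : C₁ * (q : ℝ) ^ (-(3 / 2 : ℝ)) ≤ 1 / 8 := by
    have hrpow : (q : ℝ) ^ (-(3 / 2 : ℝ)) ≤ (q : ℝ)⁻¹ := by
      rw [← Real.rpow_neg_one]
      exact Real.rpow_le_rpow_of_exponent_le hq1 (by norm_num)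
    have hrpos : 0 ≤ (q : ℝ) ^ (-(3 / 2 : ℝ)) := Real.rpow_nonneg hqpos.le _
    rcases le_or_gt 0 C₁ with hc | hc
    · calc C₁ * (q : ℝ) ^ (-(3 / 2 : ℝ)) ≤ C₁ * (q : ℝ)⁻¹ := mul_le_mul_of_nonneg_left hrpow hc
        _ ≤ 1 / 8 := by rw [← div_eq_mul_inv, div_le_iff₀ hqpos]; linarith
    · linarith [mul_nonpos_of_nonpos_of_nonneg hc.le hrpos,
        show C₁ * (q : ℝ) ^ (-(3 / 2 : ℝ)) ≤ 0 from mul_nonpos_of_nonpos_of_nonneg hc.le hrpos]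
  have hb : C₂ / q ≤ 1 / 4 := by
    rw [div_le_iff₀ hqpos]; linarith
  have hT' := abs_le.mp (le_trans hT ha)
  have hO' := abs_le.mp (le_trans hO hb)
  -- even = total − odd
  have hsplit := harmonicSum_one_eq_even_add_odd q
  constructor
  · linarith [hT'.1, hT'.2, hO'.1, hO'.2]
  · linarith [hT'.1]

/-- Non-negativity for `primeLevelFamilyTwo` (from the Lapid–Rallis / Guo fact).
[cite: LapidRallis2003, Thm. 1 (case n = 2)] -/
theorem primeLevelFamilyTwo_nonnegOn (hLR : lapidRallis2003_theorem1_gl2Twist) :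
    primeLevelFamilyTwo.NonnegOn :=
  CentralValueFamily.refine_nonnegOn (iwaniecSarnakFamily_nonnegOn (k := 2) (by norm_num) hLR)

/-- **THE WEIGHT-2 DECISION THEOREM (printed facts + the edge ⇒ no tiny `L(1,χ_D)`).** Assume the
typed statements in print: non-negativity `lapidRallis2003_theorem1_gl2Twist`, the twisted half
`iwaniec2006_twistedHalf` ((7.6) at `½`), the mixed moment `iwaniec2006_mixedMomentOverMass`
((7.3)+(7.4)), and the Petersson facts `kowalskiMichel2000_petersson`, `kowalskiMichel2000_lemma1`
(prime level, weight `2`). Then the EDGE — `UntwistedProportion 2 (½ + η)` for some `η > 0`, i.e.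
(7.5) for a harmonic proportion `> ½` of the even newforms of large squarefree level — implies
`∃ c > 0, ∃ D₀, ∀ D ≥ D₀, ∀ real primitive χ mod D: c·(log D)⁻⁴ ≤ L(1,χ)`. The level used is a
prime `p ≡ −1 (mod D)` (Linnik); only the prime-level instances of the edge are consumed. This is
the non-vacuous replacement of `lOne_lowerBound_of_untwistedProportion_ratio` at `k = 2`.
[cite: IwaniecConversations2006, §7 (7.7) and p. 97] -/
theorem lOne_lowerBound_of_untwistedProportion_weightTwo {η : ℝ} (hη : 0 < η)
    (hLR : lapidRallis2003_theorem1_gl2Twist) (hTw : iwaniec2006_twistedHalf)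
    (hMix : iwaniec2006_mixedMomentOverMass)
    (hP : KowalskiMichel2000.kowalskiMichel2000_petersson)
    (hL : KowalskiMichel2000.kowalskiMichel2000_lemma1)
    (hUn : UntwistedProportion 2 (1 / 2 + η)) :
    ∃ c : ℝ, 0 < c ∧ ∃ D₀ : ℕ, ∀ (D : ℕ) [NeZero D] (χ : DirichletCharacter ℂ D), D₀ ≤ D →
      χ.IsPrimitive → MulChar.IsQuadratic χ →
        c * ((Real.log D) ^ 4)⁻¹ ≤ (χ.LFunction 1).re := by
  have hk : (2 : ℤ) ≤ 2 := le_rfl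
  have hkev : Even (2 : ℤ) := ⟨1, rfl⟩
  obtain ⟨δ₁, hδ₁, htot⟩ := mixedOverTotalMass_iwaniecSarnakFamily hk hkev hMix
  have hε : 0 < η / 4 := by positivity
  obtain ⟨δ₂, hδ₂, htw⟩ := TwistedHalf_of_twistedProportion hε (hTw 2 hk hkev)
  have hE := EStarFam_of_untwistedProportion hε hUn
  have hδ : 0 < min δ₁ δ₂ := lt_min hδ₁ hδ₂
  obtain ⟨K, hK, hsup⟩ := primeLevelFamilyTwo_compatibleSupply hδ
  have h := primeLevelFamilyTwo.lOne_lowerBound_of_EStarFam_total' hK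
    (primeLevelFamilyTwo_nonnegOn hLR) (fun _ _ _ _ hcomp => CentralValueFamily.refine_compatible_B hcomp)
    (evenShare_primeLevelFamilyTwo hP hL)
    (CentralValueFamily.refine_mixedOverTotalMass (htot.anti (min_le_left _ _)))
    (CentralValueFamily.refine_twistedHalf (htw.anti (min_le_right _ _)))
    (CentralValueFamily.refine_EStarFam hE) (by linarith) hsup
  simpa only [show (2 * 2 : ℕ) = 4 from rfl] using h

end WeightTwo

end Literature.NumberTheory.LFunctions.CentralValueFamilyHalfEdge

end
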